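import Literature.NumberTheory.Transcendental.KZDilationStokesDescentPrep
import Mathlib.Algebra.MvPolynomial.Rename
import HarnessLib

/-!
# Stokes descent for the dilation pencil, V: the coordinate swap in dimension two

Dilation functions of cube integrands are invariant under permutations of the cube coordinates. In
dimension two this turns `x₁`-exact rational data into `x₀`-exact rational data: for
`B = P/Q ∈ ℚ(x₀,x₁)` and the swapped potential `B' = B ∘ swap` (`P' = rename swap P`,
`Q' = rename swap Q`),
  `∫_{[0,1]²} (∂₁B)(ϖz) dz = ∫_{[0,1]²} (∂₀B')(ϖz) dz`   for every `ϖ`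
(`dilation_integral_pderiv_one_eq_swap`; change of variables `z ↦ (z₁, z₀)`, measure preserving as
`finTwoArrow⁻¹ ∘ Prod.swap ∘ finTwoArrow`, and `MvPolynomial.pderiv_rename`). With the Stokes descent
for `x₀`-exact data (`KZDilationStokesDescentDimTwo.lean`) this covers divergences
`∂₀(P₀/Q₀) + ∂₁(P₁/Q₁)` of rational vector fields regular near the square (route
`KontsevichZagierPeriods/LiftingCriteria`, crux `DilationLiftAtOne`).

Everything is proved; no `def`, no named fact.

## References
* M. Kontsevich, D. Zagier, *Periods* (2001), §1.2. [`KontsevichZagier2001`]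
-/

noncomputable section

open Set MeasureTheory
open scoped BigOperators

namespace Literature.NumberTheory.Transcendental

namespace KZ.StokesDescent

/-- The coordinate swap of `ℝ²` as a composition of measurable equivalences acts by
`z ↦ z ∘ swap`. [folklore] -/
theorem swapEquiv_apply (z : Fin 2 → ℝ) :
    ((MeasurableEquiv.finTwoArrow.trans (MeasurableEquiv.prodComm.trans
      MeasurableEquiv.finTwoArrow.symm)) : (Fin 2 → ℝ) ≃ᵐ (Fin 2 → ℝ)) z =
      z ∘ (Equiv.swap (0 : Fin 2) 1) := by
  funext i
  refine Fin.cases ?_ (fun j => ?_) i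
  · simp [MeasurableEquiv.finTwoArrow, MeasurableEquiv.prodComm, Equiv.swap_apply_left]
  · have hj : j = 0 := Fin.fin_one_eq_zero j
    subst hj
    simp [MeasurableEquiv.finTwoArrow, MeasurableEquiv.prodComm, Equiv.swap_apply_right,
      show (Fin.succ (0 : Fin 1) : Fin 2) = 1 from rfl]

/-- The coordinate swap of `ℝ²` preserves Lebesgue measure. [folklore] -/
theorem measurePreserving_swapEquiv :
    MeasurePreserving ((MeasurableEquiv.finTwoArrow.trans (MeasurableEquiv.prodComm.trans
      MeasurableEquiv.finTwoArrow.symm)) : (Fin 2 → ℝ) ≃ᵐ (Fin 2 → ℝ)) volume volume := by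
  have h1 := MeasureTheory.volume_preserving_finTwoArrow ℝ
  have h2 : MeasurePreserving (MeasurableEquiv.prodComm : ℝ × ℝ ≃ᵐ ℝ × ℝ) volume volume :=
    Measure.measurePreserving_swap (μ := (volume : Measure ℝ)) (ν := (volume : Measure ℝ))
  exact (h1.symm _).comp (h2.comp h1)

/-- **Coordinate-swap invariance of cube integrals in dimension two.**
`∫_{[0,1]²} F(z) dz = ∫_{[0,1]²} F(z ∘ swap) dz`. [folklore] -/
theorem setIntegral_cube_two_comp_swap (F : (Fin 2 → ℝ) → ℝ) :
    (∫ z in Set.pi Set.univ (fun _ : Fin 2 => Icc (0:ℝ) 1), F z) =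
      ∫ z in Set.pi Set.univ (fun _ : Fin 2 => Icc (0:ℝ) 1), F (z ∘ (Equiv.swap (0 : Fin 2) 1)) := by
  set T : (Fin 2 → ℝ) ≃ᵐ (Fin 2 → ℝ) := MeasurableEquiv.finTwoArrow.trans
    (MeasurableEquiv.prodComm.trans MeasurableEquiv.finTwoArrow.symm) with hT
  have hpre : T ⁻¹' (Set.pi Set.univ (fun _ : Fin 2 => Icc (0:ℝ) 1)) =
      Set.pi Set.univ (fun _ : Fin 2 => Icc (0:ℝ) 1) := by
    ext z
    simp only [Set.mem_preimage, Set.mem_univ_pi, hT, swapEquiv_apply, Function.comp_apply]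
    constructor
    · intro h i
      simpa using h (Equiv.swap (0 : Fin 2) 1 i)
    · intro h i
      exact h _
  rw [← measurePreserving_swapEquiv.setIntegral_preimage_emb T.measurableEmbedding F
      (Set.pi Set.univ (fun _ : Fin 2 => Icc (0:ℝ) 1)), ← hT, hpre]
  refine setIntegral_congr_fun (MeasurableSet.univ_pi fun _ => measurableSet_Icc) fun z _ => ?_
  rw [hT, swapEquiv_apply]

/-- **`x₁`-exact data are `x₀`-exact data after the swap.** For `B = P/Q ∈ ℚ(x₀,x₁)`,
`P' = rename swap P`, `Q' = rename swap Q`: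
`∫_{[0,1]²} (∂₁B)(ϖz) dz = ∫_{[0,1]²} (∂₀(P'/Q'))(ϖz) dz`. [cite: KontsevichZagier2001, §1.2] -/
theorem dilation_integral_pderiv_one_eq_swap (P Q : MvPolynomial (Fin 2) ℚ) (ϖ : ℝ) :
    (∫ z in Set.pi Set.univ (fun _ : Fin 2 => Icc (0:ℝ) 1),
      (MvPolynomial.aeval (ϖ • z) (MvPolynomial.pderiv 1 P) * MvPolynomial.aeval (ϖ • z) Q -
          MvPolynomial.aeval (ϖ • z) P * MvPolynomial.aeval (ϖ • z) (MvPolynomial.pderiv 1 Q)) /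
        (MvPolynomial.aeval (ϖ • z) Q) ^ 2) =
      ∫ z in Set.pi Set.univ (fun _ : Fin 2 => Icc (0:ℝ) 1),
        (MvPolynomial.aeval (ϖ • z) (MvPolynomial.pderiv 0
              (MvPolynomial.rename (Equiv.swap (0 : Fin 2) 1) P)) *
            MvPolynomial.aeval (ϖ • z) (MvPolynomial.rename (Equiv.swap (0 : Fin 2) 1) Q) -
          MvPolynomial.aeval (ϖ • z) (MvPolynomial.rename (Equiv.swap (0 : Fin 2) 1) P) *
            MvPolynomial.aeval (ϖ • z) (MvPolynomial.pderiv 0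
              (MvPolynomial.rename (Equiv.swap (0 : Fin 2) 1) Q))) /
        (MvPolynomial.aeval (ϖ • z) (MvPolynomial.rename (Equiv.swap (0 : Fin 2) 1) Q)) ^ 2 := by
  rw [setIntegral_cube_two_comp_swap]
  refine setIntegral_congr_fun (MeasurableSet.univ_pi fun _ => measurableSet_Icc) fun z _ => ?_
  have hσ : Function.Injective (Equiv.swap (0 : Fin 2) 1) := (Equiv.swap (0 : Fin 2) 1).injective
  have hsmul : ϖ • (z ∘ (Equiv.swap (0 : Fin 2) 1)) = (ϖ • z) ∘ (Equiv.swap (0 : Fin 2) 1) := by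
    funext i; simp
  have h0 : (Equiv.swap (0 : Fin 2) 1) 1 = 0 := Equiv.swap_apply_right _ _
  have hP : MvPolynomial.pderiv 0 (MvPolynomial.rename (Equiv.swap (0 : Fin 2) 1) P) =
      MvPolynomial.rename (Equiv.swap (0 : Fin 2) 1) (MvPolynomial.pderiv 1 P) := by
    have h := MvPolynomial.pderiv_rename hσ (1 : Fin 2) P
    rw [h0] at h
    exact h
  have hQ : MvPolynomial.pderiv 0 (MvPolynomial.rename (Equiv.swap (0 : Fin 2) 1) Q) =
      MvPolynomial.rename (Equiv.swap (0 : Fin 2) 1) (MvPolynomial.pderiv 1 Q) := by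
    have h := MvPolynomial.pderiv_rename hσ (1 : Fin 2) Q
    rw [h0] at h
    exact h
  rw [hsmul, hP, hQ, MvPolynomial.aeval_rename, MvPolynomial.aeval_rename, MvPolynomial.aeval_rename,
    MvPolynomial.aeval_rename]

end KZ.StokesDescent

end Literature.NumberTheory.Transcendental
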